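import Summits.KontsevichZagierPeriods.KontsevichZagierPeriods.Theorems.SoloBlindFenceDissect
import HarnessLib

/-!
# The doubling chart (`T2`, file D2)

On the piece `F_ρ` of the fence cell (`SoloBlindFenceDissect`) the one remaining non-order
condition is `2β₀ + β_m < π/4`, `m = ρ(0)+1` the top coordinate of `u = (s₁,…,s_{n+1})`
(`β = arctan s`).  The **doubling chart**

  `Z_ρ : s ↦ (tan(2β₀ + β_m), s₁, …, s_{n+1}) = ((2s₀ + s_m(1−s₀²))/((1−s₀²) − 2s₀s_m), s₁, …)`

is a rational map with upper-triangular Jacobian (`det DZ_ρ = ∂z₀/∂s₀ > 0`), injective on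
`F_ρ`, maps `F_ρ` onto the order cell of `(0, ρ+1)` in `(0,1)^{n+2}`, and carries the weight
`2·w` to `w`:  `W(z₀)·∂z₀/∂s₀ = 2·W(s₀)` — the factor `2` of angle doubling is absorbed by
doubling the integrand (rule (3): `[F_ρ, 2w] = [F_ρ, w] + [F_ρ, w]`).  Hence, in `Q` and for
every `n`:

  `2·[F_ρ, w] = [Δ_{n+2}, w]`,   `2·[F_n, w] = fenceCount n · [Δ_{n+2}, w]`,
  `(2·(n+2)!)·[T_n, w] = ((n+2)·fenceCount n)·(2α)^{n+2}`.
-/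

noncomputable section

open Literature.NumberTheory.Transcendental Literature.NumberTheory.Transcendental.KZ
open Literature.ModelTheory.ExponentialFields
open MeasureTheory Set Real MvPolynomial

namespace Summit.KontsevichZagierPeriods.KontsevichZagierPeriods.Theorems

namespace SoloBlind

variable {n : ℕ}

/-! ## The chart -/

/-- `zTop a b = (2a + b(1−a²))/((1−a²) − 2ab)` — `tan(2·arctan a + arctan b)`. -/
def zTop (a b : ℝ) : ℝ := (2 * a + b * (1 - a ^ 2)) / ((1 - a ^ 2) - 2 * a * b)

/-- `zTop a b = addT (dblT a) b` off the poles. -/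
theorem zTop_eq_addT {a b : ℝ} (h1 : 1 - a ^ 2 ≠ 0) (h2 : (1 - a ^ 2) - 2 * a * b ≠ 0) :
    zTop a b = addT (dblT a) b := by
  rw [zTop, addT_eq, dblT_eq]
  have h3 : 1 - 2 * a / (1 - a ^ 2) * b = ((1 - a ^ 2) - 2 * a * b) / (1 - a ^ 2) := by
    field_simp
  have h4 : 2 * a / (1 - a ^ 2) + b = (2 * a + b * (1 - a ^ 2)) / (1 - a ^ 2) := by
    field_simp
  rw [h3, h4, div_div_div_cancel_right₀ h1]

/-- In angles: `arctan (zTop a b) = 2·arctan a + arctan b` on the fence range. -/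
theorem arctan_zTop {a b : ℝ} (ha : 0 < a) (ha' : a ^ 2 + 2 * a < 1) (hb : 0 < b)
    (hab : b * (1 - a ^ 2) + 2 * a * (1 + b) < 1 - a ^ 2) :
    arctan (zTop a b) = 2 * arctan a + arctan b := by
  have ha1 : a < 1 := by nlinarith
  have hq : 0 < 1 - a ^ 2 := by nlinarith
  have hD : 0 < (1 - a ^ 2) - 2 * a * b := by nlinarith
  have hdb : dblT a * b < 1 := by
    rw [dblT_eq, div_mul_eq_mul_div, div_lt_one hq]; nlinarith
  rw [zTop_eq_addT hq.ne' hD.ne', arctan_addT hdb, arctan_dblT (by linarith) ha1]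

/-- The doubling chart `Z_ρ`: `s₀ ↦ tan(2β₀ + β_m)`, `m = ρ(0)+1`, other coordinates kept. -/
def zMap (ρ : Equiv.Perm (Fin (n + 1))) (s : Fin (n + 2) → ℝ) : Fin (n + 2) → ℝ :=
  Function.update s 0 (zTop (s 0) (s (ρ 0).succ))

/-- Coordinate `0` of `Z_ρ`. -/
@[simp] theorem zMap_zero (ρ : Equiv.Perm (Fin (n + 1))) (s : Fin (n + 2) → ℝ) :
    zMap ρ s 0 = zTop (s 0) (s (ρ 0).succ) := Function.update_self ..

/-- The other coordinates of `Z_ρ`. -/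
theorem zMap_of_ne (ρ : Equiv.Perm (Fin (n + 1))) (s : Fin (n + 2) → ℝ) {i : Fin (n + 2)}
    (hi : i ≠ 0) : zMap ρ s i = s i := Function.update_of_ne hi ..

/-- The coordinates `j+1` of `Z_ρ`. -/
@[simp] theorem zMap_succ (ρ : Equiv.Perm (Fin (n + 1))) (s : Fin (n + 2) → ℝ)
    (j : Fin (n + 1)) : zMap ρ s j.succ = s j.succ := zMap_of_ne ρ s (Fin.succ_ne_zero j)

/-- The denominator of `Z_ρ` is positive on `F_n`. -/
theorem zDen_pos {s : Fin (n + 2) → ℝ} (hs : s ∈ fenceCell n) (i : Fin (n + 2)) (hi : i ≠ 0) :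
    0 < (1 - s 0 ^ 2) - 2 * s 0 * s i := by
  obtain ⟨⟨h0, h0'⟩, h1, -⟩ := hs
  nlinarith [(h1 i hi).1, (h1 i hi).2]

/-- `arctan (Z_ρ s)₀ = 2β₀ + β_m` on `F_n`. -/
theorem arctan_zMap_zero {s : Fin (n + 2) → ℝ} (hs : s ∈ fenceCell n)
    (ρ : Equiv.Perm (Fin (n + 1))) :
    arctan (zMap ρ s 0) = 2 * arctan (s 0) + arctan (s (ρ 0).succ) := by
  rw [zMap_zero]
  exact arctan_zTop hs.1.1 hs.1.2 (hs.2.1 _ (Fin.succ_ne_zero _)).1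
    (hs.2.1 _ (Fin.succ_ne_zero _)).2

/-! ## Image and injectivity -/

/-- `Z_ρ` maps `F_ρ` into the order cell of `(0, ρ+1)`. -/
theorem zMap_mem {ρ : Equiv.Perm (Fin (n + 1))} {s : Fin (n + 2) → ℝ} (hs : s ∈ fenceOrd ρ) :
    zMap ρ s ∈ (orderCellK (liftPerm ρ)).domain := by
  obtain ⟨hF, hu⟩ := hs
  obtain ⟨⟨h0, -⟩, h1, -⟩ := mem_fenceCell_iff_arctan.mp hF
  have hm := h1 (ρ 0).succ (Fin.succ_ne_zero _)
  have hz := arctan_zMap_zero hF ρ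
  have hB0 := arctan_pos.mpr h0
  have hBm := arctan_pos.mpr hm.1
  refine mem_orderCellK_liftPerm.mpr ⟨⟨?_, ?_⟩, ?_, ?_⟩
  · exact arctan_pos.mp (by rw [hz]; linarith)
  · exact arctan_lt_pi_div_four_iff.mp (by rw [hz]; linarith [hm.2])
  · simpa [Function.comp_def] using hu
  · rw [zMap_succ, ← arctan_lt_arctan_iff, hz]
    linarith

/-- `Z_ρ` is injective on `F_ρ`. -/
theorem injOn_zMap (ρ : Equiv.Perm (Fin (n + 1))) : InjOn (zMap ρ) (fenceOrd ρ) :=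
  fun s hs s' hs' h => by
  have hi : ∀ i, i ≠ 0 → s i = s' i := fun i hi => by
    rw [← zMap_of_ne ρ s hi, ← zMap_of_ne ρ s' hi, h]
  funext i
  by_cases h0 : i = 0
  · subst h0
    apply arctan_injective
    have e : arctan (zMap ρ s 0) = arctan (zMap ρ s' 0) := by rw [h]
    rw [arctan_zMap_zero hs.1, arctan_zMap_zero hs'.1, hi _ (Fin.succ_ne_zero _)] at e
    linarith
  · exact hi i h0

/-- The inverse of `Z_ρ`: halve the angle `β(z₀) − β(z_m)`. -/
def zInv (ρ : Equiv.Perm (Fin (n + 1))) (z : Fin (n + 2) → ℝ) : Fin (n + 2) → ℝ :=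
  Function.update z 0 (tan ((arctan (z 0) - arctan (z (ρ 0).succ)) / 2))

/-- The other coordinates of `Z_ρ⁻¹`. -/
theorem zInv_of_ne (ρ : Equiv.Perm (Fin (n + 1))) (z : Fin (n + 2) → ℝ) {i : Fin (n + 2)}
    (hi : i ≠ 0) : zInv ρ z i = z i := Function.update_of_ne hi ..

/-- `arctan (Z_ρ⁻¹ z)₀ = (β(z₀) − β(z_m))/2` on the target cell. -/
theorem arctan_zInv_zero {ρ : Equiv.Perm (Fin (n + 1))} {z : Fin (n + 2) → ℝ}
    (hz : z ∈ (orderCellK (liftPerm ρ)).domain) :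
    arctan (zInv ρ z 0) = (arctan (z 0) - arctan (z (ρ 0).succ)) / 2 := by
  obtain ⟨⟨-, h0'⟩, hu, hm⟩ := mem_orderCellK_liftPerm.mp hz
  have hBm : 0 < arctan (z (ρ 0).succ) := arctan_pos.mpr (orderCellK_domain_subset ρ hu (ρ 0)).1
  have hB0 : arctan (z 0) < π / 4 := arctan_lt_pi_div_four_iff.mpr h0'
  have hlt := arctan_lt_arctan_iff.mpr hm
  rw [zInv, Function.update_self]
  exact arctan_tan (by linarith [pi_pos]) (by linarith [pi_pos])

/-- `Z_ρ⁻¹` lands in `F_ρ` (`ρ ∈ fenceSet n`). -/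
theorem zInv_mem {ρ : Equiv.Perm (Fin (n + 1))} (hρ : ρ ∈ fenceSet n) {z : Fin (n + 2) → ℝ}
    (hz : z ∈ (orderCellK (liftPerm ρ)).domain) : zInv ρ z ∈ fenceOrd ρ := by
  have hs0 := arctan_zInv_zero hz
  obtain ⟨⟨-, h0'⟩, hu, hm⟩ := mem_orderCellK_liftPerm.mp hz
  have hub : ∀ j : Fin (n + 1), 0 < z j.succ ∧ z j.succ < 1 := fun j =>
    orderCellK_domain_subset ρ hu j
  have hanti : StrictAnti fun j => z (ρ j).succ := (mem_orderCellK_domain.mp hu).2.2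
  have htop : ∀ j : Fin (n + 1), z j.succ ≤ z (ρ 0).succ := fun j => by
    simpa using hanti.antitone (Fin.zero_le (ρ.symm j))
  have hBm := arctan_pos.mpr (hub (ρ 0)).1
  have hB0 : arctan (z 0) < π / 4 := arctan_lt_pi_div_four_iff.mpr h0'
  have hlt := arctan_lt_arctan_iff.mpr hm
  have htail : zInv ρ z ∘ Fin.succ = fun j => z j.succ :=
    funext fun j => zInv_of_ne ρ z (Fin.succ_ne_zero j)
  have hF : zInv ρ z ∈ fenceCell n := by
    refine mem_fenceCell_iff_arctan.mpr ⟨⟨arctan_pos.mp (by rw [hs0]; linarith),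
      by rw [hs0]; linarith⟩, fun i hi => ?_, ?_⟩
    · obtain ⟨j, rfl⟩ := Fin.exists_succ_eq.mpr hi
      rw [zInv_of_ne ρ z hi, hs0]
      exact ⟨(hub j).1, by linarith [arctan_strictMono.monotone (htop j)]⟩
    · rw [isFence_iff_tail, show (fun j => zInv ρ z j.succ) = zInv ρ z ∘ Fin.succ from rfl, htail]
      exact (isFenceTail_iff_perm hanti).mpr (mem_fenceSet.mp hρ)
  refine ⟨hF, ?_⟩
  show zInv ρ z ∘ Fin.succ ∈ (orderCellK ρ).domain
  rw [htail]
  exact hu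

/-- `Z_ρ ∘ Z_ρ⁻¹ = id` on the target cell. -/
theorem zMap_zInv {ρ : Equiv.Perm (Fin (n + 1))} (hρ : ρ ∈ fenceSet n) {z : Fin (n + 2) → ℝ}
    (hz : z ∈ (orderCellK (liftPerm ρ)).domain) : zMap ρ (zInv ρ z) = z := by
  have hs := zInv_mem hρ hz
  funext i
  by_cases hi : i = 0
  · subst hi
    apply arctan_injective
    rw [arctan_zMap_zero hs.1, zInv_of_ne ρ z (Fin.succ_ne_zero _), arctan_zInv_zero hz]
    ring
  · rw [zMap_of_ne ρ _ hi, zInv_of_ne ρ z hi]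

/-- **`Z_ρ '' F_ρ = C_{(0,ρ+1)}`** (`ρ ∈ fenceSet n`). -/
theorem image_zMap {ρ : Equiv.Perm (Fin (n + 1))} (hρ : ρ ∈ fenceSet n) :
    zMap ρ '' fenceOrd ρ = (orderCellK (liftPerm ρ)).domain :=
  Subset.antisymm (image_subset_iff.mpr fun _ hs => zMap_mem hs)
    fun z hz => ⟨zInv ρ z, zInv_mem hρ hz, zMap_zInv hρ hz⟩

/-! ## Derivative and Jacobian -/

/-- `∂z₀/∂s₀`. -/
def zD (ρ : Equiv.Perm (Fin (n + 1))) (s : Fin (n + 2) → ℝ) : ℝ :=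
  2 * (1 + s 0 ^ 2) * (1 + s (ρ 0).succ ^ 2) / ((1 - s 0 ^ 2) - 2 * s 0 * s (ρ 0).succ) ^ 2

/-- `∂z₀/∂s_m`. -/
def zC (ρ : Equiv.Perm (Fin (n + 1))) (s : Fin (n + 2) → ℝ) : ℝ :=
  (1 + s 0 ^ 2) ^ 2 / ((1 - s 0 ^ 2) - 2 * s 0 * s (ρ 0).succ) ^ 2

/-- Diagonal entries of `DZ_ρ`. -/
def zd (ρ : Equiv.Perm (Fin (n + 1))) (s : Fin (n + 2) → ℝ) (i : Fin (n + 2)) : ℝ :=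
  if i = 0 then zD ρ s else 1

/-- Column-`m` entries of `DZ_ρ` (off the diagonal). -/
def zc (ρ : Equiv.Perm (Fin (n + 1))) (s : Fin (n + 2) → ℝ) (i : Fin (n + 2)) : ℝ :=
  if i = 0 then zC ρ s else 0

/-- `DZ_ρ(s)`: row `i` is `zd i • e_i* + zc i • e_m*`. -/
def zDeriv (ρ : Equiv.Perm (Fin (n + 1))) (s : Fin (n + 2) → ℝ) :
    (Fin (n + 2) → ℝ) →L[ℝ] (Fin (n + 2) → ℝ) :=
  ContinuousLinearMap.pi fun i =>
    zd ρ s i • ContinuousLinearMap.proj (R := ℝ) (φ := fun _ : Fin (n + 2) => ℝ) i +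
      zc ρ s i • ContinuousLinearMap.proj (R := ℝ) (φ := fun _ : Fin (n + 2) => ℝ) (ρ 0).succ

/-- The derivative applied to a vector. -/
theorem zDeriv_apply (ρ : Equiv.Perm (Fin (n + 1))) (s v : Fin (n + 2) → ℝ) (i : Fin (n + 2)) :
    zDeriv ρ s v i = zd ρ s i * v i + zc ρ s i * v (ρ 0).succ := by
  simp [zDeriv]

/-- `Z_ρ` has derivative `DZ_ρ` on `F_n`. -/
theorem hasFDerivAt_zMap {s : Fin (n + 2) → ℝ} (hs : s ∈ fenceCell n)
    (ρ : Equiv.Perm (Fin (n + 1))) : HasFDerivAt (zMap ρ) (zDeriv ρ s) s := by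
  have hD := zDen_pos hs (ρ 0).succ (Fin.succ_ne_zero _)
  change HasFDerivAt (fun s i => zMap ρ s i) (ContinuousLinearMap.pi fun i : Fin (n + 2) =>
    zd ρ s i • ContinuousLinearMap.proj (R := ℝ) (φ := fun _ : Fin (n + 2) => ℝ) i +
      zc ρ s i • ContinuousLinearMap.proj (R := ℝ) (φ := fun _ : Fin (n + 2) => ℝ) (ρ 0).succ) s
  rw [hasFDerivAt_pi]
  intro i
  have e0 := hasFDerivAt_apply (𝕜 := ℝ) (F' := fun _ : Fin (n + 2) => ℝ) 0 s
  have em := hasFDerivAt_apply (𝕜 := ℝ) (F' := fun _ : Fin (n + 2) => ℝ) (ρ 0).succ s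
  have ei := hasFDerivAt_apply (𝕜 := ℝ) (F' := fun _ : Fin (n + 2) => ℝ) i s
  by_cases hi : i = 0
  · subst hi
    simp only [zMap_zero, zTop]
    refine hasFDerivAt_ratio (F := fun y : Fin (n + 2) → ℝ =>
        (2 * y 0 + y (ρ 0).succ * (1 - y 0 ^ 2)) / ((1 - y 0 ^ 2) - 2 * y 0 * y (ρ 0).succ))
      (fun z => by simp; ring)
      ((e0.const_mul 2).add (em.mul ((e0.mul e0).const_sub 1)))
      (((e0.mul e0).const_sub 1).sub ((e0.const_mul 2).mul em))
      (ne_of_gt (by simp only [Pi.sub_apply, Pi.mul_apply]; nlinarith [hD])) fun v => ?_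
    have hD1 : (1 - s 0 ^ 2) - 2 * s 0 * s (ρ 0).succ ≠ 0 := hD.ne'
    have hD2 : 1 - s 0 * s 0 - 2 * s 0 * s (ρ 0).succ ≠ 0 := by rw [← sq]; exact hD1
    simp [zd, zc, zD, zC]
    field_simp
    ring
  · simp only [zMap_of_ne ρ _ hi]
    refine ei.congr_fderiv (ContinuousLinearMap.ext fun v => ?_)
    simp [zd, zc, hi]

/-- The matrix of `DZ_ρ(s)`: diagonal `zd` plus column `m` `zc`. -/
theorem toMatrix_zDeriv (ρ : Equiv.Perm (Fin (n + 1))) (s : Fin (n + 2) → ℝ) :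
    LinearMap.toMatrix' ((zDeriv ρ s : (Fin (n + 2) → ℝ) →L[ℝ] (Fin (n + 2) → ℝ)) :
      (Fin (n + 2) → ℝ) →ₗ[ℝ] (Fin (n + 2) → ℝ)) =
      Matrix.of fun i j => (if j = i then zd ρ s i else 0) +
        (if j = (ρ 0).succ then zc ρ s i else 0) := by
  ext i j
  rw [LinearMap.toMatrix'_apply, ContinuousLinearMap.coe_coe, zDeriv_apply, Matrix.of_apply]
  simp only [Pi.single_apply, mul_ite, mul_one, mul_zero]
  congr 1 <;> split_ifs with h1 h2 h2 <;>
    first | rfl | exact absurd h1.symm h2 | exact absurd h2.symm h1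

/-- `det DZ_ρ(s) = ∂z₀/∂s₀` (upper triangular). -/
theorem det_zDeriv (ρ : Equiv.Perm (Fin (n + 1))) (s : Fin (n + 2) → ℝ) :
    (zDeriv ρ s).det = zD ρ s := by
  rw [ContinuousLinearMap.det, ← LinearMap.det_toMatrix', toMatrix_zDeriv,
    Matrix.det_of_upperTriangular]
  · have h : ∀ i : Fin (n + 2), (Matrix.of fun i j : Fin (n + 2) =>
        (if j = i then zd ρ s i else 0) + (if j = (ρ 0).succ then zc ρ s i else 0)) i i =
        if i = 0 then zD ρ s else 1 := fun i => by
      rw [Matrix.of_apply]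
      by_cases hi : i = 0
      · subst hi; simp [zd, (Fin.succ_ne_zero (ρ 0)).symm]
      · simp [zd, zc, hi]
    simp only [h, Finset.prod_ite_eq', Finset.mem_univ, if_true]
  · intro i j hij
    have hij : j < i := hij
    have hi : i ≠ 0 := (lt_of_le_of_lt (Fin.zero_le j) hij).ne'
    simp [Matrix.of_apply, zc, hi, hij.ne]

/-- `∂z₀/∂s₀ > 0` on `F_n`. -/
theorem zD_pos {s : Fin (n + 2) → ℝ} (hs : s ∈ fenceCell n) (ρ : Equiv.Perm (Fin (n + 1))) :
    0 < zD ρ s :=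
  div_pos (by positivity) (pow_pos (zDen_pos hs (ρ 0).succ (Fin.succ_ne_zero _)) 2)

/-! ## Weight doubling -/

/-- `N² + D² = (1+a²)²(1+b²)` for the numerator and denominator of `zTop`. -/
theorem zTop_aux (a b : ℝ) : (2 * a + b * (1 - a ^ 2)) ^ 2 + ((1 - a ^ 2) - 2 * a * b) ^ 2 =
    (1 + a ^ 2) ^ 2 * (1 + b ^ 2) := by
  ring

/-- **`W(z₀)·∂z₀/∂s₀ = 2·W(s₀)`**: angle doubling doubles the weight. -/
theorem tW_zMap_mul {s : Fin (n + 2) → ℝ} (hs : s ∈ fenceCell n)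
    (ρ : Equiv.Perm (Fin (n + 1))) : tW (zMap ρ s 0) * zD ρ s = 2 * tW (s 0) := by
  have hD := (zDen_pos hs (ρ 0).succ (Fin.succ_ne_zero _)).ne'
  rw [zMap_zero, zTop, zD, tW, tW]
  set a := s 0
  set b := s (ρ 0).succ
  have ha : (1 : ℝ) + a ^ 2 ≠ 0 := by positivity
  have hb : (1 : ℝ) + b ^ 2 ≠ 0 := by positivity
  have h1 : 1 + ((2 * a + b * (1 - a ^ 2)) / ((1 - a ^ 2) - 2 * a * b)) ^ 2 =
      (1 + a ^ 2) ^ 2 * (1 + b ^ 2) / ((1 - a ^ 2) - 2 * a * b) ^ 2 := by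
    rw [← zTop_aux, div_pow]
    field_simp
    ring
  rw [h1]
  field_simp

/-- `w(Z_ρ s)·det DZ_ρ(s) = 2·w(s)` on `F_n`. -/
theorem angWeight_zMap_mul {s : Fin (n + 2) → ℝ} (hs : s ∈ fenceCell n)
    (ρ : Equiv.Perm (Fin (n + 1))) :
    angWeight (n + 2) (zMap ρ s) * zD ρ s = 2 * angWeight (n + 2) s := by
  rw [angWeight_eq, angWeight_eq, Fin.prod_univ_succ (n := n + 1),
    Fin.prod_univ_succ (n := n + 1)]
  simp only [zMap_succ]
  rw [mul_right_comm, tW_zMap_mul hs ρ]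
  ring

/-! ## `Z_ρ` is a rational map -/

/-- `Z_ρ` is a `ℚ`-semialgebraic (rational) map on `F_ρ`. -/
theorem isSemialgebraicMapOn_zMap (ρ : Equiv.Perm (Fin (n + 1))) :
    IsSemialgebraicMapOn ℚ (fenceOrd ρ) (zMap ρ) := by
  refine IsSemialgebraicMapOn.of_forall (isSemialgebraic_fenceOrd ρ) fun i => ?_
  by_cases hi : i = 0
  · subst hi
    refine (isSemialgebraicFunOn_aeval_div_aeval (isSemialgebraic_fenceOrd ρ)
      (2 * X 0 + X (ρ 0).succ * (1 - X 0 ^ 2)) ((1 - X 0 ^ 2) - 2 * X 0 * X (ρ 0).succ)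
      fun s hs => ?_).congr fun s _ => by simp [zTop]
    have h := zDen_pos hs.1 (ρ 0).succ (Fin.succ_ne_zero _)
    simpa using h.ne'
  · exact (isSemialgebraicFunOn_aeval (isSemialgebraic_fenceOrd ρ) (X i)).congr
      fun s _ => by simp [zMap_of_ne ρ _ hi]

/-! ## The move -/

/-- `[F_ρ, 2w]`. -/
def fenceOrdPiece₂ (ρ : Equiv.Perm (Fin (n + 1))) : IntegralRep (n + 2) :=
  (fenceOrdPiece ρ).constMul 2 (by exact_mod_cast isAlgebraic_nat 2)

/-- Rule (3): `[F_ρ, 2w] − [F_ρ, w] − [F_ρ, w] ∈ relations`. -/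
theorem fenceOrdPiece₂_sub (ρ : Equiv.Perm (Fin (n + 1))) :
    of (fenceOrdPiece₂ ρ) - of (fenceOrdPiece ρ) - of (fenceOrdPiece ρ) ∈ relations :=
  of_sub_sub_mem_relations_of_add rfl rfl fun x _ => by
    simp [fenceOrdPiece₂, IntegralRep.constMul, two_mul]

/-- **Rule (2) along `Z_ρ`: `[F_ρ, 2w] ≡ [C_{(0,ρ+1)}, w]`** (`ρ ∈ fenceSet n`). -/
theorem fenceOrdPiece₂_equiv {ρ : Equiv.Perm (Fin (n + 1))} (hρ : ρ ∈ fenceSet n) :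
    Equivalent (fenceOrdPiece₂ ρ) (orderCellK (liftPerm ρ)) :=
  equivalent_of_chart (f := fun s => 2 * angWeight (n + 2) s) (g := angWeight (n + 2))
    (J := zD ρ) (isSemialgebraicMapOn_zMap ρ) (fun s hs => hasFDerivAt_zMap hs.1 ρ)
    (injOn_zMap ρ) (image_zMap hρ)
    (fun s hs => by rw [det_zDeriv, abs_of_pos (zD_pos hs.1 ρ)])
    (fun s hs => (angWeight_zMap_mul hs.1 ρ).symm) rfl
    (fun s _ => by simp [fenceOrdPiece₂, IntegralRep.constMul, fenceOrdPiece, angPiece_integrand])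
    rfl fun z _ => orderCellK_integrand _ z

/-- **`2·[F_ρ, w] = [Δ_{n+2}, w]` in `Q`** (`ρ ∈ fenceSet n`). -/
theorem two_nsmul_mkQ_fenceOrdPiece {ρ : Equiv.Perm (Fin (n + 1))} (hρ : ρ ∈ fenceSet n) :
    2 • mkQ (of (fenceOrdPiece ρ)) = mkQ (of (simplexPieceK (n + 2))) := by
  have h1 : mkQ (of (fenceOrdPiece₂ ρ)) = mkQ (of (fenceOrdPiece ρ) + of (fenceOrdPiece ρ)) :=
    mkQ_eq_mkQ_iff.mpr (by rw [sub_add_eq_sub_sub]; exact fenceOrdPiece₂_sub ρ)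
  have h2 : mkQ (of (fenceOrdPiece₂ ρ)) = mkQ (of (orderCellK (liftPerm ρ))) :=
    mkQ_eq_mkQ_iff.mpr (fenceOrdPiece₂_equiv hρ)
  have h3 : mkQ (of (simplexPieceK (n + 2))) = mkQ (of (orderCellK (liftPerm ρ))) :=
    mkQ_eq_mkQ_iff.mpr (simplexPieceK_sub_orderCellK _)
  rw [two_nsmul, ← map_add, ← h1, h2, h3]

/-- **`2·[F_n, w] = fenceCount n · [Δ_{n+2}, w]` in `Q`**, for every `n`. -/
theorem two_nsmul_mkQ_fencePiece (n : ℕ) :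
    2 • mkQ (of (fencePiece n)) = fenceCount n • mkQ (of (simplexPieceK (n + 2))) := by
  rw [mkQ_fencePiece_eq_sum, Finset.smul_sum, fenceCount, ← Finset.sum_const]
  exact Finset.sum_congr rfl fun ρ hρ => two_nsmul_mkQ_fenceOrdPiece hρ

/-- **`(2·(n+2)!)·[T_n, w] = ((n+2)·fenceCount n)·(2α)^{n+2}` in `Q`**, for every `n`:
the tangent cell is commensurable with `α^{n+2}` inside the rules, in every dimension. -/
theorem nsmul_mkQ_cycPiece_fence (n : ℕ) :
    (2 * (n + 2).factorial) • mkQ (of (cycPiece n)) =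
      ((n + 2) * fenceCount n) • ((2 : K₀) • alpha 1) ^ (n + 2) := by
  rw [mkQ_cycPiece_eq_nsmul_fencePiece, ← factorial_nsmul_simplexPieceK, smul_smul, smul_smul,
    show 2 * (n + 2).factorial * (n + 2) = (n + 2).factorial * (n + 2) * 2 by ring, ← smul_smul,
    two_nsmul_mkQ_fencePiece, smul_smul]
  congr 1
  ring

end SoloBlind

end Summit.KontsevichZagierPeriods.KontsevichZagierPeriods.Theorems
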